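import Summits.NavierStokesRegularity.NavierStokesRegularity.Theorems.AdaptedFrequencyConverges.Negative.EpsFlow

/-!
# The ε-family, II: arbitrarily small oscillation, local Type-I constant and kernel deviation — still no limit

Negative-side support for crux `AdaptedFrequencyConverges` (stmt-NavierStokesRegularity-10493), cdisprove seat.
The ε-kernel `G_ε = N(0, diag(α_ε, β_ε, β_ε))` is an exact adapted kernel of the ε-flow (`adjoint_eq_GE`, unit mass,
concentration, comparability with constants within `e^{±4|ε|}` of the heat kernel's); the adapted frequency is
`Λ = 2ε cos log(1−t)` (`frequencyE_eq`) — oscillation budget `2|ε|`, no limit for `ε ≠ 0` (`not_tendsto_frequencyE`);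
the parabolic-local Type-I constant is eventually `≤ |ε|‖D₀‖ + δ` (`local_typeI_velE`); `(1,0)` is backward-singular
(`singular_velE`).  Hence the δ-small strengthening (inline; `AdaptedFrequencyConvergesWithoutDecaySmall δ` in Disproof.lean) — the crux without far-field hypotheses but
WITH (S1) local Type-I constant `≤ δ`, (S2) kernel comparability within `e^{±δ}` of the backward heat kernel, (S3) an
a-priori budget `|Λ| ≤ δ` eventually — is FALSE for every `δ > 0` (`adaptedFrequencyConverges_false_without_decay_small`):
no smallness threshold can be bootstrapped to convergence without a far-field input (uniform local energy near `x₀`).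
-/

noncomputable section

namespace Summit.NavierStokesRegularity.NavierStokesRegularity.Theorems.AdaptedFrequencyConverges.Negative

open scoped Matrix InnerProductSpace RealInnerProductSpace Laplacian Topology
open Literature.Analysis.FluidPDE Set Filter MeasureTheory Real intervalIntegral

/-- **the ε-kernel** `G_ε(t) = N(0, diag(α_ε, β_ε, β_ε))`. [folklore] -/
def GE (ν ε t : ℝ) (x : E3) : ℝ := gK (varAE ν ε t) (varBE ν ε t) x

/-- `G_ε > 0`. [folklore] -/
theorem GE_pos {ν : ℝ} (hν : 0 < ν) (ε : ℝ) {t : ℝ} (ht : t < 1) (x : E3) : 0 < GE ν ε t x :=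
  gK_pos (varAE_pos hν ε ht) (varBE_pos hν ε ht) x

/-- unit mass of `G_ε`. [folklore] -/
theorem integral_GE {ν : ℝ} (hν : 0 < ν) (ε : ℝ) {t : ℝ} (ht : t < 1) : ∫ x, GE ν ε t x = 1 :=
  integral_gK (varAE_pos hν ε ht) (varBE_pos hν ε ht)

/-- **adjoint equation for the ε-kernel**. [folklore] -/
theorem adjoint_eq_GE {ν : ℝ} (hν : 0 < ν) (ε : ℝ) {t : ℝ} (ht : t ∈ Ico (0:ℝ) 1) (x : E3) :
    timeDerivWithin (Ico 0 1) (GE ν ε) t x + fderiv ℝ (GE ν ε t) x (velE ε t x) +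
      ν * (Δ (GE ν ε t)) x = 0 := by
  have hA := varAE_pos hν ε ht.2
  have hB := varBE_pos hν ε ht.2
  have hd : HasDerivAt (fun s => GE ν ε s x) _ t :=
    hasDerivAt_gK_comp (hasDerivAt_varAE ν ε ht.2) (hasDerivAt_varBE ν ε ht.2) hA hB x
  rw [timeDerivWithin_apply, (hd.hasDerivWithinAt).derivWithin (uniqueDiffOn_Ico 0 1 t ht)]
  rw [show GE ν ε t = gK (varAE ν ε t) (varBE ν ε t) from rfl, fderiv_gK_apply, laplacian_gK]
  simp only [velE, linVel_apply0, linVel_apply1, linVel_apply2]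
  field_simp
  ring

/-- joint smoothness of `G_ε` on `(−∞,1) × ℝ³`. [folklore] -/
theorem contDiffOn_uncurry_GE (ν : ℝ) (hν : 0 < ν) (ε : ℝ) {n : ℕ∞} :
    ContDiffOn ℝ (n : WithTop ℕ∞) (Function.uncurry (GE ν ε)) (Iio 1 ×ˢ univ) := by
  have hmaps : MapsTo (Prod.fst : ℝ × E3 → ℝ) (Iio 1 ×ˢ univ) (Iio 1) := fun p hp =>
    (mem_prod.1 hp).1
  have hA : ContDiffOn ℝ n (fun p : ℝ × E3 => varAE ν ε p.1) (Iio 1 ×ˢ univ) :=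
    ((contDiffOn_varAE ν ε).of_le (by exact_mod_cast le_top)).comp contDiffOn_fst hmaps
  have hB : ContDiffOn ℝ n (fun p : ℝ × E3 => varBE ν ε p.1) (Iio 1 ×ˢ univ) :=
    ((contDiffOn_varBE ν ε).of_le (by exact_mod_cast le_top)).comp contDiffOn_fst hmaps
  have hc : ∀ i : Fin 3, ContDiffOn ℝ n (fun p : ℝ × E3 => (p.2 i) ^ 2) (Iio 1 ×ˢ univ) := fun i =>
    (((crd i).contDiff.comp contDiff_snd).pow 2).contDiffOn
  have hC : ContDiffOn ℝ n (fun p : ℝ × E3 => gC (varAE ν ε p.1) (varBE ν ε p.1)) (Iio 1 ×ˢ univ) := by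
    unfold gC
    refine ContDiffOn.inv ?_ fun p hp => ?_
    · refine ((contDiffOn_const.mul hA).sqrt fun p hp => ?_).mul (contDiffOn_const.mul hB)
      have := varAE_pos hν ε (mem_prod.1 hp).1
      positivity
    · have := varAE_pos hν ε (mem_prod.1 hp).1
      have := varBE_pos hν ε (mem_prod.1 hp).1
      positivity
  have hQ : ContDiffOn ℝ n (fun p : ℝ × E3 => gQ (varAE ν ε p.1) (varBE ν ε p.1) p.2) (Iio 1 ×ˢ univ) := by
    unfold gQ
    refine ((hc 0).div (contDiffOn_const.mul hA) fun p hp => ?_).add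
      (((hc 1).add (hc 2)).div (contDiffOn_const.mul hB) fun p hp => ?_)
    · exact mul_ne_zero two_ne_zero (varAE_pos hν ε (mem_prod.1 hp).1).ne'
    · exact mul_ne_zero two_ne_zero (varBE_pos hν ε (mem_prod.1 hp).1).ne'
  exact hC.mul hQ.neg.exp

/-- **comparability of `G_ε` with constants within `e^{±4|ε|}` of the heat kernel's `4ν`**. [folklore] -/
theorem GE_comparable {ν : ℝ} (hν : 0 < ν) (ε : ℝ) :
    ∀ t ∈ Ico (0:ℝ) 1, ∀ x : E3,
      (2 * π * (2 * ν * Real.exp (4 * |ε|))) ^ (-(3:ℝ) / 2) * (1 - t) ^ (-(3:ℝ) / 2) *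
          Real.exp (-(‖x - 0‖ ^ 2) / ((4 * ν * Real.exp (-(4 * |ε|))) * (1 - t))) ≤ GE ν ε t x ∧
        GE ν ε t x ≤ (2 * π * (2 * ν * Real.exp (-(4 * |ε|)))) ^ (-(3:ℝ) / 2) * (1 - t) ^ (-(3:ℝ) / 2) *
          Real.exp (-(‖x - 0‖ ^ 2) / ((4 * ν * Real.exp (4 * |ε|)) * (1 - t))) := by
  intro t ht x
  set m := 2 * ν * Real.exp (-(4 * |ε|)) with hm
  set M := 2 * ν * Real.exp (4 * |ε|) with hM
  have hm0 : 0 < m := by positivity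
  have hM0 : 0 < M := by positivity
  have hτ : 0 < 1 - t := sub_pos.2 ht.2
  obtain ⟨hA1, hA2⟩ := varAE_bounds hν.le ε ht.2.le
  obtain ⟨hB1, hB2⟩ := varBE_bounds hν.le ε ht.2.le
  have e1 : Real.exp (-(4 * |ε|)) ≤ Real.exp (-(2 * |ε|)) := Real.exp_le_exp.2 (by linarith [abs_nonneg ε])
  have e2 : Real.exp (2 * |ε|) ≤ Real.exp (4 * |ε|) := Real.exp_le_exp.2 (by linarith [abs_nonneg ε])
  have hmA : m * (1 - t) ≤ varAE ν ε t := by rw [hm]; linarith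
  have hmB : m * (1 - t) ≤ varBE ν ε t := by
    rw [hm]; nlinarith [mul_le_mul_of_nonneg_right e1 (by positivity : (0:ℝ) ≤ 2 * ν * (1 - t))]
  have hAM : varAE ν ε t ≤ M * (1 - t) := by rw [hM]; linarith
  have hBM : varBE ν ε t ≤ M * (1 - t) := by
    rw [hM]; nlinarith [mul_le_mul_of_nonneg_right e2 (by positivity : (0:ℝ) ≤ 2 * ν * (1 - t))]
  rw [sub_zero, show 4 * ν * Real.exp (-(4 * |ε|)) = 2 * m by rw [hm]; ring,
    show 4 * ν * Real.exp (4 * |ε|) = 2 * M by rw [hM]; ring]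
  constructor
  · have h := le_gK (mul_pos hm0 hτ) hmA hmB hAM hBM x
    rw [gC_mul_self hM0 hτ] at h
    calc (2 * π * M) ^ (-(3:ℝ) / 2) * (1 - t) ^ (-(3:ℝ) / 2) * Real.exp (-‖x‖ ^ 2 / (2 * m * (1 - t)))
        = (2 * π * M) ^ (-(3:ℝ) / 2) * (1 - t) ^ (-(3:ℝ) / 2) *
            Real.exp (-‖x‖ ^ 2 / (2 * (m * (1 - t)))) := by rw [mul_assoc 2 m]
      _ ≤ GE ν ε t x := h
  · have h := gK_le (mul_pos hm0 hτ) hmA hmB hAM hBM x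
    rw [gC_mul_self hm0 hτ] at h
    calc GE ν ε t x ≤ (2 * π * m) ^ (-(3:ℝ) / 2) * (1 - t) ^ (-(3:ℝ) / 2) *
            Real.exp (-‖x‖ ^ 2 / (2 * (M * (1 - t)))) := h
      _ = (2 * π * m) ^ (-(3:ℝ) / 2) * (1 - t) ^ (-(3:ℝ) / 2) *
            Real.exp (-‖x‖ ^ 2 / (2 * M * (1 - t))) := by rw [mul_assoc 2 M]

/-- concentration of `G_ε` at the pole (via the general heat-kernel-bound lemma). [folklore] -/
theorem tendsto_integral_mul_GE {ν : ℝ} (hν : 0 < ν) (ε : ℝ) {φ : E3 → ℝ} (hφ : Continuous φ)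
    (hM : ∃ M : ℝ, ∀ x, |φ x| ≤ M) :
    Tendsto (fun t => ∫ x, φ x * GE ν ε t x) (𝓝[<] 1) (𝓝 (φ 0)) := by
  obtain ⟨M, hM⟩ := hM
  set C₁ := (2 * π * (2 * ν * Real.exp (-(4 * |ε|)))) ^ (-(3:ℝ) / 2) with hC₁
  set C₂ := 4 * ν * Real.exp (4 * |ε|) with hC₂
  have hC₂0 : 0 < C₂ := by positivity
  refine tendsto_integral_mul_of_le_heatKernel (K := C₁ * (4 * π * (C₂ / 4)) ^ ((3:ℝ) / 2))
    (ν' := C₂ / 4) (by positivity) ?_ hφ hM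
  filter_upwards [Ico_mem_nhdsLT zero_lt_one] with t ht
  refine ⟨fun x => (GE_pos hν ε ht.2 x).le, integral_GE hν ε ht.2, fun x => ?_⟩
  have hτ : 0 < 1 - t := sub_pos.2 ht.2
  rw [backwardHeatKernel_eq (by positivity) 0 ht.2 x]
  simp only [finrank_euclideanSpace_fin, Nat.cast_ofNat]
  rw [show 4 * (C₂ / 4) * (1 - t) = C₂ * (1 - t) by ring]
  have hpow : (4 * π * (C₂ / 4)) ^ ((3:ℝ) / 2) * (4 * π * (C₂ / 4)) ^ (-(3:ℝ) / 2) = 1 := by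
    rw [← Real.rpow_add (by positivity)]; norm_num
  calc GE ν ε t x ≤ C₁ * (1 - t) ^ (-(3:ℝ) / 2) * Real.exp (-(‖x - 0‖ ^ 2) / (C₂ * (1 - t))) :=
        ((GE_comparable hν ε) t ht x).2
    _ = C₁ * ((4 * π * (C₂ / 4)) ^ ((3:ℝ) / 2) * (4 * π * (C₂ / 4)) ^ (-(3:ℝ) / 2)) *
          (1 - t) ^ (-(3:ℝ) / 2) * Real.exp (-(‖x - 0‖ ^ 2) / (C₂ * (1 - t))) := by rw [hpow, mul_one]
    _ = _ := by ring

/-! ### ε-frequency, local Type-I constant, singularity, and the small-constant refutation -/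

/-- the adapted enstrophy of the ε-witness is `ω_ε²`. [folklore] -/
theorem integral_curl_velE_sq_mul_GE {ν : ℝ} (hν : 0 < ν) (ε : ℝ) {t : ℝ} (ht : t < 1) :
    ∫ x, ‖curl (velE ε t) x‖ ^ 2 * GE ν ε t x = ampE ε t ^ 2 := by
  rw [show velE ε t = linVel (strE ε t) (ampE ε t) from rfl]
  simp_rw [norm_curl_linVel_sq]
  rw [MeasureTheory.integral_const_mul, integral_GE hν ε ht, mul_one]

/-- **the adapted frequency of the ε-witness is `2ε cos log(1−t)`**. [folklore] -/
theorem frequencyE_eq {ν : ℝ} (hν : 0 < ν) (ε : ℝ) {H Λ : ℝ → ℝ}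
    (hH : H = fun t => ∫ x, ‖curl (velE ε t) x‖ ^ 2 * GE ν ε t x)
    (hΛ : Λ = fun t => (1 - t) * deriv H t / H t) {t : ℝ} (ht : t < 1) :
    Λ t = 2 * ε * Real.cos (Real.log (1 - t)) := by
  have hHeq : H =ᶠ[𝓝 t] fun s => ampE ε s ^ 2 := by
    filter_upwards [Iio_mem_nhds ht] with s hs
    rw [hH]; exact integral_curl_velE_sq_mul_GE hν ε hs
  have hd : deriv H t = 2 * ampE ε t * (ampE ε t * strE ε t) := by
    rw [hHeq.deriv_eq]
    have h2 : HasDerivAt (fun s => ampE ε s ^ 2)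
        (((2 : ℕ) : ℝ) * ampE ε t ^ (2 - 1) * (ampE ε t * strE ε t)) t := (hasDerivAt_ampE ε ht).pow 2
    rw [h2.deriv]; norm_num
  have hHt : H t = ampE ε t ^ 2 := hHeq.eq_of_nhds
  rw [hΛ]
  simp only [hd, hHt, strE, str]
  have ha : ampE ε t ≠ 0 := (ampE_pos ε t).ne'
  have h1 : (1 - t) ≠ 0 := (sub_pos.2 ht).ne'
  field_simp

/-- **no limit for any `ε ≠ 0`**, although `|Λ| ≤ 2|ε|`. [folklore] -/
theorem not_tendsto_frequencyE {ν : ℝ} (hν : 0 < ν) {ε : ℝ} (hε : ε ≠ 0) {H Λ : ℝ → ℝ}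
    (hH : H = fun t => ∫ x, ‖curl (velE ε t) x‖ ^ 2 * GE ν ε t x)
    (hΛ : Λ = fun t => (1 - t) * deriv H t / H t) :
    ¬ ∃ Λ₀ : ℝ, Tendsto Λ (𝓝[<] 1) (𝓝 Λ₀) := by
  rintro ⟨Λ₀, hlim⟩
  have hseq : ∀ c : ℝ, Tendsto (fun n : ℕ => 1 - Real.exp (-(n * (2 * π) + c))) atTop (𝓝[<] (1:ℝ)) := by
    intro c
    refine tendsto_nhdsWithin_iff.2 ⟨?_, Eventually.of_forall fun n => ?_⟩
    · have h1 : Tendsto (fun n : ℕ => (n : ℝ) * (2 * π) + c) atTop atTop :=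
        tendsto_atTop_add_const_right _ _ (tendsto_natCast_atTop_atTop.atTop_mul_const (by positivity))
      simpa using (Real.tendsto_exp_neg_atTop_nhds_zero.comp h1).const_sub (1:ℝ)
    · exact sub_lt_self _ (Real.exp_pos _)
  have hval : ∀ (c : ℝ) (n : ℕ), Λ (1 - Real.exp (-(n * (2 * π) + c))) =
      2 * ε * Real.cos (n * (2 * π) + c) := by
    intro c n
    rw [frequencyE_eq hν ε hH hΛ (sub_lt_self _ (Real.exp_pos _)), sub_sub_cancel, Real.log_exp,
      Real.cos_neg]
  have hlim0 := hlim.comp (hseq 0)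
  have hlimπ := hlim.comp (hseq π)
  have e0 : (Λ ∘ fun n : ℕ => 1 - Real.exp (-(n * (2 * π) + 0))) = fun _ => 2 * ε := by
    funext n; rw [Function.comp_apply, hval, add_zero, Real.cos_nat_mul_two_pi]; ring
  have eπ : (Λ ∘ fun n : ℕ => 1 - Real.exp (-(n * (2 * π) + π))) = fun _ => -(2 * ε) := by
    funext n; rw [Function.comp_apply, hval, Real.cos_nat_mul_two_pi_add_pi]; ring
  rw [e0] at hlim0
  rw [eπ] at hlimπ
  have h2 : Λ₀ = 2 * ε := tendsto_nhds_unique hlim0 tendsto_const_nhds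
  have hm2 : Λ₀ = -(2 * ε) := tendsto_nhds_unique hlimπ tendsto_const_nhds
  exact hε (by linarith)

/-- **the local Type-I constant of the ε-witness is `O(ε)` eventually**: on `‖x‖² ≤ 1 − t`,
`‖u_ε‖ ≤ (|ε|‖D₀‖ + e^{|ε|}‖J‖ (1−t)/2) / √(1−t) ≤ 2|ε|‖D₀‖ … ` — stated with the explicit constant
`|ε| ‖D₀‖ + δ` for any `δ > 0`, eventually as `t ↑ 1`. [folklore] -/
theorem local_typeI_velE (ε : ℝ) {δ : ℝ} (hδ : 0 < δ) : ∀ᶠ t in 𝓝[<] (1:ℝ), ∀ x : E3, ‖x - 0‖ ^ 2 ≤ 1 - t →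
    ‖velE ε t x‖ ≤ (|ε| * ‖D0‖ + δ) / Real.sqrt (1 - t) := by
  -- eventually `e^{|ε|} ‖J‖ (1 − t) / 2 ≤ δ`
  have hev : ∀ᶠ t in 𝓝[<] (1:ℝ), Real.exp |ε| / 2 * ‖J‖ * (1 - t) ≤ δ := by
    have hc : Tendsto (fun t : ℝ => Real.exp |ε| / 2 * ‖J‖ * (1 - t)) (𝓝[<] (1:ℝ)) (𝓝 0) := by
      have : Tendsto (fun t : ℝ => Real.exp |ε| / 2 * ‖J‖ * (1 - t)) (𝓝 (1:ℝ))
          (𝓝 (Real.exp |ε| / 2 * ‖J‖ * (1 - 1))) :=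
        ((continuous_const.mul (continuous_const.sub continuous_id)).tendsto 1)
      rw [sub_self, mul_zero] at this
      exact this.mono_left nhdsWithin_le_nhds
    exact (hc.eventually (ge_mem_nhds hδ))
  filter_upwards [Ico_mem_nhdsLT zero_lt_one, hev] with t ht hδt x hx
  rw [sub_zero] at hx
  have hτ : 0 < 1 - t := sub_pos.2 ht.2
  have hsq : 0 < Real.sqrt (1 - t) := Real.sqrt_pos.2 hτ
  have hxle : ‖x‖ ≤ Real.sqrt (1 - t) := by
    rw [← Real.sqrt_sq (norm_nonneg x)]; exact Real.sqrt_le_sqrt hx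
  have hstr : |strE ε t| ≤ |ε| * (1 / (1 - t)) := by
    rw [strE, abs_mul, str, abs_div, abs_of_pos hτ]
    exact mul_le_mul_of_nonneg_left (div_le_div_of_nonneg_right (Real.abs_cos_le_one _) hτ.le)
      (abs_nonneg _)
  have hamp : |ampE ε t / 2| ≤ Real.exp |ε| / 2 := by
    rw [abs_of_pos (by have := ampE_pos ε t; positivity)]; linarith [ampE_le ε t]
  have h1 : ‖velE ε t x‖ ≤ |strE ε t| * (‖D0‖ * ‖x‖) + |ampE ε t / 2| * (‖J‖ * ‖x‖) := by
    unfold velE linVel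
    refine (norm_add_le _ _).trans (add_le_add ?_ ?_)
    · rw [norm_smul, Real.norm_eq_abs]
      exact mul_le_mul_of_nonneg_left (D0.le_opNorm x) (abs_nonneg _)
    · rw [norm_smul, Real.norm_eq_abs]
      exact mul_le_mul_of_nonneg_left (J.le_opNorm x) (abs_nonneg _)
  have hinv : 1 / (1 - t) * Real.sqrt (1 - t) = 1 / Real.sqrt (1 - t) := by
    field_simp
    rw [Real.sq_sqrt hτ.le]
  have hsqrt_eq : Real.sqrt (1 - t) = (1 - t) * (1 / Real.sqrt (1 - t)) := by
    field_simp
    rw [Real.sq_sqrt hτ.le]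
  calc ‖velE ε t x‖ ≤ |strE ε t| * (‖D0‖ * ‖x‖) + |ampE ε t / 2| * (‖J‖ * ‖x‖) := h1
    _ ≤ (|ε| * (1 / (1 - t))) * (‖D0‖ * Real.sqrt (1 - t)) +
          (Real.exp |ε| / 2) * (‖J‖ * Real.sqrt (1 - t)) := by gcongr
    _ = |ε| * ‖D0‖ * (1 / (1 - t) * Real.sqrt (1 - t)) +
          Real.exp |ε| / 2 * ‖J‖ * Real.sqrt (1 - t) := by ring
    _ = |ε| * ‖D0‖ * (1 / Real.sqrt (1 - t)) +
          (Real.exp |ε| / 2 * ‖J‖ * (1 - t)) * (1 / Real.sqrt (1 - t)) := by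
        rw [hinv]; nth_rewrite 2 [hsqrt_eq]; ring
    _ ≤ |ε| * ‖D0‖ * (1 / Real.sqrt (1 - t)) + δ * (1 / Real.sqrt (1 - t)) := by
        gcongr
    _ = (|ε| * ‖D0‖ + δ) / Real.sqrt (1 - t) := by ring

/-- the ε-flow on the axis. [folklore] -/
theorem velE_axis (ε t r : ℝ) :
    velE ε t (EuclideanSpace.single 0 r) = EuclideanSpace.single 0 (strE ε t * r) := by
  ext i
  fin_cases i <;> simp [velE]

/-- **backward singularity of `(1,0)` for the ε-flow**, `ε ≠ 0`. [folklore] -/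
theorem singular_velE {ε : ℝ} (hε : ε ≠ 0) (r : ℝ) (hr : 0 < r) :
    eLpNorm (Function.uncurry (velE ε)) ⊤
      (volume.restrict (parabolicCylinder r ((1:ℝ), (0 : E3)))) = ⊤ := by
  by_contra hne
  set S := eLpNorm (Function.uncurry (velE ε)) ⊤
    (volume.restrict (parabolicCylinder r ((1:ℝ), (0:E3)))) with hS
  have hae : ∀ᵐ p ∂(volume.restrict (parabolicCylinder r ((1:ℝ), (0:E3)))),
      ‖Function.uncurry (velE ε) p‖ₑ ≤ S := by
    rw [hS, eLpNorm_exponent_top]; exact ae_le_eLpNormEssSup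
  have hε0 : 0 < |ε| := abs_pos.2 hε
  obtain ⟨n, hn⟩ : ∃ n : ℕ, max (Real.log (r ^ 2)⁻¹)
      (Real.log ((S.toReal + 1) / (|ε| * (r / 2)))) < n * (2 * π) := by
    obtain ⟨n, hn⟩ := exists_nat_gt (max (Real.log (r ^ 2)⁻¹)
      (Real.log ((S.toReal + 1) / (|ε| * (r / 2)))) / (2 * π))
    exact ⟨n, (div_lt_iff₀ (by positivity)).1 hn⟩
  have hn1 : Real.exp (-(n * (2 * π))) < r ^ 2 := by
    rw [Real.exp_neg, inv_lt_comm₀ (Real.exp_pos _) (by positivity),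
      ← Real.log_lt_iff_lt_exp (by positivity)]
    exact (le_max_left _ _).trans_lt hn
  have hn2 : S.toReal + 1 < |ε| * (r / 2) * Real.exp (n * (2 * π)) := by
    rw [← div_lt_iff₀' (by positivity), ← Real.log_lt_iff_lt_exp (by positivity)]
    exact (le_max_right _ _).trans_lt hn
  set t₀ : ℝ := 1 - Real.exp (-(n * (2 * π))) with ht₀
  set x₀ : E3 := EuclideanSpace.single 0 (r / 2) with hx₀
  have ht₀1 : t₀ < 1 := sub_lt_self _ (Real.exp_pos _)
  have hval : ‖velE ε t₀ x₀‖ = |ε| * (r / 2) * Real.exp (n * (2 * π)) := by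
    rw [hx₀, velE_axis, strE, ht₀, str_special, norm_single_zero, abs_mul, abs_mul,
      abs_of_pos (Real.exp_pos _), abs_of_pos (by positivity : (0:ℝ) < r / 2)]
    ring
  set U : Set (ℝ × E3) := {p | S.toReal + 1 < ‖Function.uncurry (velE ε) p‖} ∩ (Iio 1 ×ˢ univ) with hU
  have hcont : ContinuousOn (fun p : ℝ × E3 => ‖Function.uncurry (velE ε) p‖) (Iio 1 ×ˢ univ) :=
    fun p hp => ((contDiffAt_uncurry_velE ε (n := 0) (mem_prod.1 hp).1 p.2).continuousAt.norm
      ).continuousWithinAt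
  have hUo : IsOpen U := by
    rw [hU, inter_comm]
    exact hcont.isOpen_inter_preimage (isOpen_Iio.prod isOpen_univ) isOpen_Ioi
  have hmem : ((t₀, x₀) : ℝ × E3) ∈ U ∩ parabolicCylinder r ((1:ℝ), (0:E3)) := by
    refine ⟨⟨?_, ht₀1, mem_univ _⟩, ?_⟩
    · show S.toReal + 1 < ‖velE ε t₀ x₀‖
      rw [hval]; exact hn2
    · rw [mem_parabolicCylinder]
      refine ⟨⟨by rw [ht₀]; linarith, ht₀1⟩, ?_⟩
      rw [hx₀, dist_zero_right, norm_single_zero, abs_of_pos (by positivity)]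
      linarith
  have hpos : 0 < volume (U ∩ parabolicCylinder r ((1:ℝ), (0:E3))) :=
    (hUo.inter (isOpen_parabolicCylinder r _)).measure_pos volume ⟨_, hmem⟩
  have hnull : volume.restrict (parabolicCylinder r ((1:ℝ), (0:E3))) U = 0 := by
    refine measure_eq_zero_iff_ae_notMem.2 ?_
    filter_upwards [hae] with p hp hpU
    have h2 : S.toReal + 1 < ‖Function.uncurry (velE ε) p‖ := hpU.1
    have h3 : (‖Function.uncurry (velE ε) p‖ₑ).toReal ≤ S.toReal := ENNReal.toReal_mono hne hp
    rw [toReal_enorm] at h3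
    linarith
  rw [Measure.restrict_apply hUo.measurableSet] at hnull
  exact hpos.ne' hnull

/-- **TIGHTNESS: no smallness threshold helps without a far-field hypothesis.**  The negated statement
(INLINE; it is `AdaptedFrequencyConvergesWithoutDecaySmall δ` of the crux workfile Disproof.lean) is the
crux without its far-field hypotheses (as in `adaptedFrequencyConverges_false_without_decay`) STRENGTHENED
by three smallness hypotheses with parameter `δ > 0`: (S1) the parabolic-local Type-I constant is `≤ δ`;
(S2) the kernel is Gaussian-comparable with `c₂ = 4νe^{−δ}`, `C₂ = 4νe^{δ}`, `c₁ = (4πνe^{δ})^{-3/2}`,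
`C₁ = (4πνe^{−δ})^{-3/2}` (within `e^{±δ}` of the backward heat kernel); (S3) an a-priori oscillation
budget `|Λ t| ≤ δ` eventually.  For every `δ > 0` it is still false: take `ε = min(δ/4, δ/(2‖D₀‖+2))`-ish; concretely
`ε := δ / (4 * (‖D₀‖ + 1))`, so that `4|ε| ≤ δ`, `|ε|‖D₀‖ + |ε| ≤ δ` and `2|ε| ≤ δ`. [folklore] -/
theorem adaptedFrequencyConverges_false_without_decay_small {δ : ℝ} (hδ : 0 < δ) :
    ¬ (∀ (ν T : ℝ), 0 < ν → 0 < T → ∀ (u : ℝ → EuclideanSpace ℝ (Fin 3) → EuclideanSpace ℝ (Fin 3)) (p : ℝ → EuclideanSpace ℝ (Fin 3) → ℝ), Literature.Analysis.FluidPDE.IsClassicalNSSolutionOn (Set.Ico 0 T) ν 0 u p → ∀ (x₀ : EuclideanSpace ℝ (Fin 3)) (t₀ : ℝ) (G : ℝ → EuclideanSpace ℝ (Fin 3) → ℝ), t₀ ∈ Set.Ico 0 T → (∀ᶠ t in 𝓝[<] T, ∀ x, ‖x - x₀‖ ^ 2 ≤ T - t → ‖u t x‖ ≤ δ / Real.sqrt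 (T - t)) → (∀ r : ℝ, 0 < r → MeasureTheory.eLpNorm (Function.uncurry u) ⊤ (MeasureTheory.Measure.restrict MeasureTheory.volume (Literature.Analysis.FluidPDE.parabolicCylinder r (T, x₀))) = ⊤) → ContDiffOn ℝ 2 (Function.uncurry G) (Set.Ico t₀ T ×ˢ Set.univ) ∧ (∀ t ∈ Set.Ico t₀ T, ∀ x, 0 < G t x) ∧ (∀ t ∈ Set.Ico t₀ T, ∀ x, Literature.Analysis.FluidPDE.timeDerivWithin (Set.Ico t₀ T) G t x + fderiv ℝ (G t) x (u t x) + ν * Laplacian.laplacian (G t) x = 0) ∧ (∀ t ∈ Set.Ico t₀ T, ∫ x, G t x = 1) ∧ (∀ φ : EuclideanSpace ℝ (Fin 3) → ℝ, Continuous φ → (∃ M : ℝ, ∀ x, |φ x| ≤ M) → Filter.Tendsto (fun t => ∫ x, φ x * G t x) (nhdsWithin T (Set.Iio T)) (nhds (φ x₀))) → (∀ t ∈ Set.Ico t₀ T, ∀ x, (4 * π * ν * Real.exp δ) ^ (-(3:ℝ) / 2) * (T - t) ^ (-(3:ℝ) / 2) * Real.exp (-(‖x - x₀‖ ^ 2)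 / ((4 * ν * Real.exp (-δ)) * (T - t))) ≤ G t x ∧ G t x ≤ (4 * π * ν * Real.exp (-δ)) ^ (-(3:ℝ) / 2) * (T - t) ^ (-(3:ℝ) / 2) * Real.exp (-(‖x - x₀‖ ^ 2) / ((4 * ν * Real.exp δ) * (T - t)))) → ∀ H Λ : ℝ → ℝ, H = (fun t => ∫ x, ‖Literature.Analysis.FluidPDE.curl (u t) x‖ ^ 2 * G t x) → Λ = (fun t => (T - t) * deriv H t / H t) → (∀ᶠ t in 𝓝[<] T, |Λ t| ≤ δ) → ∃ Λ₀ : ℝ, Filter.Tendsto Λ (nhdsWithin T (Set.Iio T)) (nhds Λ₀)) := by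
  intro h
  set ε : ℝ := δ / (4 * (‖D0‖ + 1)) with hε
  have hD : 0 ≤ ‖D0‖ := norm_nonneg _
  have hε0 : 0 < ε := by rw [hε]; positivity
  have hεabs : |ε| = ε := abs_of_pos hε0
  have hε4 : 4 * |ε| ≤ δ := by
    rw [hεabs, hε, div_eq_mul_inv]
    have : (4 * (‖D0‖ + 1))⁻¹ ≤ 4⁻¹ := by
      apply inv_anti₀ (by norm_num); nlinarith
    nlinarith
  have hεD : |ε| * ‖D0‖ + |ε| ≤ δ := by
    rw [hεabs, hε]
    rw [show δ / (4 * (‖D0‖ + 1)) * ‖D0‖ + δ / (4 * (‖D0‖ + 1)) = δ * ((‖D0‖ + 1) / (4 * (‖D0‖ + 1))) by ring]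
    rw [show (‖D0‖ + 1) / (4 * (‖D0‖ + 1)) = 1 / 4 by field_simp]
    linarith
  have h1 : (0:ℝ) < 1 := one_pos
  -- local Type-I with constant ≤ δ
  have hTI : ∀ᶠ t in 𝓝[<] (1:ℝ), ∀ x : E3, ‖x - 0‖ ^ 2 ≤ 1 - t →
      ‖velE ε t x‖ ≤ δ / Real.sqrt (1 - t) := by
    filter_upwards [local_typeI_velE ε hε0, self_mem_nhdsWithin] with t ht ht1 x hx
    refine (ht x hx).trans (div_le_div_of_nonneg_right ?_ (Real.sqrt_nonneg _))
    linarith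
  -- comparability with δ-constants from the 4|ε|-constants
  have hcomp : ∀ t ∈ Set.Ico (0:ℝ) 1, ∀ x : E3,
      (4 * π * 1 * Real.exp δ) ^ (-(3:ℝ) / 2) * (1 - t) ^ (-(3:ℝ) / 2) *
          Real.exp (-(‖x - 0‖ ^ 2) / ((4 * 1 * Real.exp (-δ)) * (1 - t))) ≤ GE 1 ε t x ∧
        GE 1 ε t x ≤ (4 * π * 1 * Real.exp (-δ)) ^ (-(3:ℝ) / 2) * (1 - t) ^ (-(3:ℝ) / 2) *
          Real.exp (-(‖x - 0‖ ^ 2) / ((4 * 1 * Real.exp δ) * (1 - t))) := by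
    intro t ht x
    obtain ⟨hlo, hhi⟩ := GE_comparable h1 ε t ht x
    have hτ : 0 < 1 - t := sub_pos.2 ht.2
    have hn : 0 ≤ ‖x - 0‖ ^ 2 := sq_nonneg _
    have e1 : Real.exp (4 * |ε|) ≤ Real.exp δ := Real.exp_le_exp.2 hε4
    have e2 : Real.exp (-δ) ≤ Real.exp (-(4 * |ε|)) := Real.exp_le_exp.2 (by linarith)
    constructor
    · refine le_trans ?_ hlo
      have hA : (4 * π * 1 * Real.exp δ) ^ (-(3:ℝ) / 2) ≤
          (2 * π * (2 * 1 * Real.exp (4 * |ε|))) ^ (-(3:ℝ) / 2) := by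
        apply Real.rpow_le_rpow_of_nonpos (by positivity) ?_ (by norm_num)
        nlinarith [Real.pi_pos]
      have hB : Real.exp (-(‖x - 0‖ ^ 2) / ((4 * 1 * Real.exp (-δ)) * (1 - t))) ≤
          Real.exp (-(‖x - 0‖ ^ 2) / ((4 * 1 * Real.exp (-(4 * |ε|))) * (1 - t))) := by
        rw [Real.exp_le_exp, neg_div, neg_div, neg_le_neg_iff]
        apply div_le_div_of_nonneg_left hn (by positivity)
        gcongr
      exact mul_le_mul (mul_le_mul_of_nonneg_right hA (by positivity)) hB (by positivity)
        (by positivity)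
    · refine le_trans hhi ?_
      have hA : (2 * π * (2 * 1 * Real.exp (-(4 * |ε|)))) ^ (-(3:ℝ) / 2) ≤
          (4 * π * 1 * Real.exp (-δ)) ^ (-(3:ℝ) / 2) := by
        apply Real.rpow_le_rpow_of_nonpos (by positivity) ?_ (by norm_num)
        nlinarith [Real.pi_pos]
      have hB : Real.exp (-(‖x - 0‖ ^ 2) / ((4 * 1 * Real.exp (4 * |ε|)) * (1 - t))) ≤
          Real.exp (-(‖x - 0‖ ^ 2) / ((4 * 1 * Real.exp δ) * (1 - t))) := by
        rw [Real.exp_le_exp, neg_div, neg_div, neg_le_neg_iff]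
        apply div_le_div_of_nonneg_left hn (by positivity)
        gcongr
      exact mul_le_mul (mul_le_mul_of_nonneg_right hA (by positivity)) hB (by positivity)
        (by positivity)
  -- oscillation budget |Λ| ≤ 2|ε| ≤ δ
  obtain ⟨Λ₀, hlim⟩ := h 1 1 h1 h1 (velE ε) (presE ε) (isClassicalNSSolutionOn_velE ε 1) 0 0 (GE 1 ε)
    ⟨le_rfl, h1⟩ hTI (singular_velE hε0.ne') ⟨(contDiffOn_uncurry_GE 1 h1 ε (n := 2)).mono
      (prod_mono Ico_subset_Iio_self Subset.rfl), fun _ ht x => GE_pos h1 ε ht.2 x,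
      fun _ ht x => adjoint_eq_GE h1 ε ht x, fun _ ht => integral_GE h1 ε ht.2,
      fun _ hφ hM => tendsto_integral_mul_GE h1 ε hφ hM⟩ hcomp _ _ rfl rfl (by
        filter_upwards [Ico_mem_nhdsLT zero_lt_one] with t ht
        rw [frequencyE_eq h1 ε rfl rfl ht.2, abs_mul, abs_mul, abs_two, hεabs]
        have := Real.abs_cos_le_one (Real.log (1 - t))
        nlinarith)
  exact not_tendsto_frequencyE h1 hε0.ne' rfl rfl ⟨Λ₀, hlim⟩


end Summit.NavierStokesRegularity.NavierStokesRegularity.Theorems.AdaptedFrequencyConverges.Negative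

end
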